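import Literature.IUT.HodgeArakelov.LabelClassesOfCuspsCor24iGenuineGraphTowerComap
import Literature.IUT.HodgeArakelov.LabelClassesOfCuspsCor24iiOfSpecialFibreAgreement
import HarnessLib

/-!
# [IUTchII] Cor 2.4 (i)′ and (ii)(iii)′ at the genuine pair `ofPiCHat ↔ ofSpecialFibre(X̲_v)` — ONE existential, ONE datum

S. Mochizuki, *Inter-universal Teichmüller Theory II*, kurims manuscript (Dec. 2020), §2 Cor. 2.4 (i)(ii)(iii) pp. 69–71, Def. 2.3 (i)(ii) pp. 67–68.
[cite: Mochizuki2012, II Cor 2.4 (i)(ii) pp.69–71]  abc-iut cell, layer L6, nodes **IUTchII:Cor2.4(i)** (lineage abc-iut-w4-d012 / L6-t19 / w5-d132)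
and **IUTchII:Cor2.4(ii)** (lineage abc-iut-w6-d069); seat abc-iut-w6-d069 (gen 2).  PROOF-ONLY (0 `def`): the statement and proof of
`cor24_i'_ofPiCHat_of_graphTower_comap` (p440067) are reproduced VERBATIM and two conjuncts are ADDED inside its existential, discharged by this
seat's `cor24_ii_iii'_ofPiCHat_of_specialFibreAgreement` (p447814) and `nonempty_cuspidalInertia_piV_of_specialFibreAgreement` (p448280) — so a
certificate writer obtains BOTH Cor. 2.4 nodes for the SAME cuspidal datum `Cu` and agreement `A` (the witnesses of an `∃` cannot otherwise be
shared across two theorems).  Nothing new is claimed; every input stays a named hypothesis exactly as in the two sources; no side is taken on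
[IUTchIII] Cor. 3.12; typed ≠ proved.
-/

noncomputable section

namespace Literature.IUT.HodgeArakelov

open Literature.AnabelianGeometry.EtaleTheta Literature.AnabelianGeometry.SemiGraphs Literature.IUT.HodgeTheaters
open _root_.Topology
open scoped Pointwise

namespace PlusMinusTower

variable {p : ℕ} [Fact p.Prime] {M : MuTwoSetting p} (e : M.CLevelData)
  {E : M.toThetaSetting.EtaleThetaData} {l : ℕ} (C : E.DoubleUnderline l) {N : ℕ+}
  (μ : M.toThetaSetting.CyclotomeMod l N) (hC : M.toThetaSetting.Compat) (hS : M.toThetaSetting.Sec2Hyps)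
  (hl : l.Prime) (hp2 : p ≠ 2) (hpl : p ≠ l) (hζ : ∃ ζ : M.toThetaSetting.K, IsPrimitiveRoot ζ (4 * l))
  {η : (C.thetaEnvData μ hC hS).PiYdd → MuN p N} (hη : η ∈ (C.thetaEnvData μ hC hS).thetaCocycles)
  (hZ : Thm16Sub.KerToZIsCompactlyGenerated M.toThetaSetting) (hN : (C.Huu.subgroupOf (M.GtpXu l)).Normal)
  {P : TopGroup.{0}} (T : TemperedCoverings (BadPlaceSetting.ofUnderline C μ hC hS hl hp2 hpl hζ hη) P)

/-- **[IUTchII] Cor 2.4 (i)′ AND Cor 2.4 (ii)(iii)′ AT THE GENUINE PAIR, FOR ONE AND THE SAME DATUM** (kurims pp. 69–71): abc-iut-w4-d012's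
`cor24_i'_ofPiCHat_of_graphTower_comap` (p440067; statement and proof VERBATIM — its `∃ (Cu, A)` with bicontinuity, `eHat ∘ emb = ιX ∘ plainIso`,
the levels clause, and `Cor24_i'` modulo the per-`□` GraphTower inputs) EXTENDED by two conjuncts for the SAME `(Cu, A)`: (1) the typed
`Cor24_ii_iii' (ofPiCHat …) Cu H` for every `H`, modulo ⟨node Cor. 2.4 (i) at this datum (`h24i`); (S) `hsurj`; (E) `hcap`; F-1704; F-1708; F-3213 R2 at
`N = 2`⟩ (this seat's `cor24_ii_iii'_ofPiCHat_of_specialFibreAgreement`, p447814), and (2) NON-VACUITY of the `Π_v`-family given a cusp of `X`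
(`nonempty_cuspidalInertia_piV_of_specialFibreAgreement`, p448280).  A by-name package for the layer certificate: both Cor. 2.4 nodes at the
genuine pair `ofPiCHat ↔ ofSpecialFibre(X̲_v)` read off one existential.  PROVED (p440067's proof + the two named theorems).
([IUTchII] Cor 2.4 (i)(ii), kurims pp.69–71) [claim: Mochizuki2012, status: disputed] -/
theorem exists_cor24_i'_and_cor24_ii_iii'_ofPiCHat_of_graphTower_comap [(M.GtpXu l).FiniteIndex] [FiniteDimensional ℚ_[p] M.K]
    (hDopen : ∀ (x : M.toTemperedCurve.Pt) (g : M.toTemperedCurve.PiTemp),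
      IsOpen (M.toTemperedCurve.aug '' ((M.toTemperedCurve.decompOfOpenAt (M.GtpXu l) x g).map (M.GtpXu l).subtype :
        Set M.toTemperedCurve.PiTemp)))
    (d : (M.toTemperedCurve.ofOpenSubgroup (M.GtpXu l) (M.toThetaSetting.isOpen_GtpXu l) M.K (range_aug_GtpXu_eq_GK C) hDopen).GroupLevelData)
    (Sf : SpecialFibreData ((M.toTemperedCurve.ofOpenSubgroup (M.GtpXu l) (M.toThetaSetting.isOpen_GtpXu l) M.K (range_aug_GtpXu_eq_GK C) hDopen).toTemperedArithmeticGroup d))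
    (h36 : Sf.Gc.Prop36Hypotheses) (Sigma SigmaHat : Set ℕ) (hsub : Sigma ⊆ SigmaHat) (hne : Sigma.Nonempty)
    (hprime : ∀ q ∈ SigmaHat, q.Prime) (hp : p ∉ Sigma) (TpH : Subgroup Sf.chart.G)
    (HatH : Subgroup (TemperedGraphGroupData.exists_completion_of_prop36 Sf.Gc h36 Sf.chart).choose)
    (hle : TpH.map (TemperedGraphGroupData.exists_completion_of_prop36 Sf.Gc h36 Sf.chart).choose_spec.choose.toMonoidHom ≤ HatH)
    (cuspMeetsH : {x : (M.toTemperedCurve.ofOpenSubgroup (M.GtpXu l) (M.toThetaSetting.isOpen_GtpXu l) M.K (range_aug_GtpXu_eq_GK C) hDopen).Pt // (M.toTemperedCurve.ofOpenSubgroup (M.GtpXu l) (M.toThetaSetting.isOpen_GtpXu l) M.K (range_aug_GtpXu_eq_GK C) hDopen).IsCusp x} → Prop)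
    {D : EtaleThetaData (BadPlaceSetting.ofUnderline C μ hC hS hl hp2 hpl hζ hη).toThetaSetting P}
    (Dec : SubgraphDecomposition (BadPlaceSetting.ofUnderline C μ hC hS hl hp2 hpl hζ hη) T D) :
    ∃ (Cu : CuspidalInertiaData (ofPiCHat e C μ hC hS hl hp2 hpl hζ hη hZ hN T))
      (A : StableCurveAgreement (ofPiCHat e C μ hC hS hl hp2 hpl hζ hη hZ hN T) Cu
        (StableCurveTemperedData.ofSpecialFibre (M.toTemperedCurve.ofOpenSubgroup (M.GtpXu l) (M.toThetaSetting.isOpen_GtpXu l) M.K (range_aug_GtpXu_eq_GK C) hDopen) d Sf h36 Sigma SigmaHat hsub hne hprime hp TpH HatH hle cuspMeetsH)),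
      IsHomeomorph A.eHat ∧
      (∀ x : T.Xplain,
        A.eHat ⟨(ofPiCHat e C μ hC hS hl hp2 hpl hζ hη hZ hN T).emb x, (ofPiCHat e C μ hC hS hl hp2 hpl hζ hη hZ hN T).emb_le_pmHat ⟨x, rfl⟩⟩ =
          (StableCurveTemperedData.ofSpecialFibre (M.toTemperedCurve.ofOpenSubgroup (M.GtpXu l) (M.toThetaSetting.isOpen_GtpXu l) M.K (range_aug_GtpXu_eq_GK C) hDopen) d Sf h36 Sigma SigmaHat hsub hne hprime hp TpH HatH hle cuspMeetsH).ιX (T.plainIso x)) ∧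
      (∀ (Q I : Subgroup (ofPiCHat e C μ hC hS hl hp2 hpl hζ hη hZ hN T).Corhat), Cu.IsCuspidalInertia Q I ↔
        I ≤ Q ∧ ∃ I₀, Cu.IsCuspidalInertia (ofPiCHat e C μ hC hS hl hp2 hpl hζ hη hZ hN T).piPM I₀ ∧ I = I₀ ⊓ Q) ∧
      (∀ H : Subgroup P,
        (∀ I : Subgroup (ofPiCHat e C μ hC hS hl hp2 hpl hζ hη hZ hN T).Corhat,
          Cu.IsCuspidalInertia (ofPiCHat e C μ hC hS hl hp2 hpl hζ hη hZ hN T).piV I → I ≤ (ofPiCHat e C μ hC hS hl hp2 hpl hζ hη hZ hN T).deltaBox H →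
            Literature.IUT.HodgeArakelov.Cor24_i (ofPiCHat e C μ hC hS hl hp2 hpl hζ hη hZ hN T) Cu H I) →
        (∀ n : (ofPiCHat e C μ hC hS hl hp2 hpl hζ hη hZ hN T).Corhat, n ∈ (ofPiCHat e C μ hC hS hl hp2 hpl hζ hη hZ hN T).piV →
          ∃ m : (ofPiCHat e C μ hC hS hl hp2 hpl hζ hη hZ hN T).Corhat, m ∈ (ofPiCHat e C μ hC hS hl hp2 hpl hζ hη hZ hN T).pmBox H ∧ m⁻¹ * n ∈ (ofPiCHat e C μ hC hS hl hp2 hpl hζ hη hZ hN T).aug.ker) →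
        (ofPiCHat e C μ hC hS hl hp2 hpl hζ hη hZ hN T).pmBox H ⊓ (ofPiCHat e C μ hC hS hl hp2 hpl hζ hη hZ hN T).piV ≤ (ofPiCHat e C μ hC hS hl hp2 hpl hζ hη hZ hN T).box H →
        M.toTemperedCurve.IsoPreservesCuspidalDecomp M.toTemperedCurve →
        M.toTemperedCurve.DecompEqCommensuratorOfOpenInertia →
        Thm16Sub.GtpYNFromCusp M.toThetaSetting 2 →
          Literature.IUT.HodgeArakelov.Cor24_ii_iii' (ofPiCHat e C μ hC hS hl hp2 hpl hζ hη hZ hN T) Cu H) ∧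
      (∀ x₀ : M.Pt, M.IsCusp x₀ → Nonempty {I // Cu.IsCuspidalInertia (ofPiCHat e C μ hC hS hl hp2 hpl hζ hη hZ hN T).piV I}) ∧
      ∀ {L : LabCuspStructure Cu} (Ld : LabelledDecomposition Dec L),
        (StableCurveTemperedData.ofSpecialFibre (M.toTemperedCurve.ofOpenSubgroup (M.GtpXu l) (M.toThetaSetting.isOpen_GtpXu l) M.K (range_aug_GtpXu_eq_GK C) hDopen) d Sf h36 Sigma SigmaHat hsub hne hprime hp TpH HatH hle cuspMeetsH).Prop24i →
        ∀ {I : Subgroup (ofPiCHat e C μ hC hS hl hp2 hpl hζ hη hZ hN T).Corhat},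
          (∀ H : Subgroup P, Cor24_family Dec Ld H →
            ∃ (TpH' : Subgroup Sf.chart.G) (HatH' : Subgroup (TemperedGraphGroupData.exists_completion_of_prop36 Sf.Gc h36 Sf.chart).choose)
              (hle' : TpH'.map (TemperedGraphGroupData.exists_completion_of_prop36 Sf.Gc h36 Sf.chart).choose_spec.choose.toMonoidHom ≤ HatH')
              (cMH' : {x : (M.toTemperedCurve.ofOpenSubgroup (M.GtpXu l) (M.toThetaSetting.isOpen_GtpXu l) M.K (range_aug_GtpXu_eq_GK C) hDopen).Pt // (M.toTemperedCurve.ofOpenSubgroup (M.GtpXu l) (M.toThetaSetting.isOpen_GtpXu l) M.K (range_aug_GtpXu_eq_GK C) hDopen).IsCusp x} → Prop)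
              (_ : ((StableCurveTemperedData.ofSpecialFibre (M.toTemperedCurve.ofOpenSubgroup (M.GtpXu l) (M.toThetaSetting.isOpen_GtpXu l) M.K (range_aug_GtpXu_eq_GK C) hDopen) d Sf h36 Sigma SigmaHat hsub hne hprime hp TpH' HatH' hle' cMH').graph.HatH :
                  Set (StableCurveTemperedData.ofSpecialFibre (M.toTemperedCurve.ofOpenSubgroup (M.GtpXu l) (M.toThetaSetting.isOpen_GtpXu l) M.K (range_aug_GtpXu_eq_GK C) hDopen) d Sf h36 Sigma SigmaHat hsub hne hprime hp TpH' HatH' hle' cMH').graph.Hat) =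
                closure ((StableCurveTemperedData.ofSpecialFibre (M.toTemperedCurve.ofOpenSubgroup (M.GtpXu l) (M.toThetaSetting.isOpen_GtpXu l) M.K (range_aug_GtpXu_eq_GK C) hDopen) d Sf h36 Sigma SigmaHat hsub hne hprime hp TpH' HatH' hle' cMH').graph.ι ''
                  (StableCurveTemperedData.ofSpecialFibre (M.toTemperedCurve.ofOpenSubgroup (M.GtpXu l) (M.toThetaSetting.isOpen_GtpXu l) M.K (range_aug_GtpXu_eq_GK C) hDopen) d Sf h36 Sigma SigmaHat hsub hne hprime hp TpH' HatH' hle' cMH').graph.TpH))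
              (_ : H = ((StableCurveTemperedData.ofSpecialFibre (M.toTemperedCurve.ofOpenSubgroup (M.GtpXu l) (M.toThetaSetting.isOpen_GtpXu l) M.K (range_aug_GtpXu_eq_GK C) hDopen) d Sf h36 Sigma SigmaHat hsub hne hprime hp TpH' HatH' hle' cMH').piTpXH.comap
                  T.plainIso.toMulEquiv.toMonoidHom).comap T.incl)
              (_ : (StableCurveTemperedData.ofSpecialFibre (M.toTemperedCurve.ofOpenSubgroup (M.GtpXu l) (M.toThetaSetting.isOpen_GtpXu l) M.K (range_aug_GtpXu_eq_GK C) hDopen) d Sf h36 Sigma SigmaHat hsub hne hprime hp TpH' HatH' hle' cMH').Cor23Hyp)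
              (_ : (StableCurveTemperedData.ofSpecialFibre (M.toTemperedCurve.ofOpenSubgroup (M.GtpXu l) (M.toThetaSetting.isOpen_GtpXu l) M.K (range_aug_GtpXu_eq_GK C) hDopen) d Sf h36 Sigma SigmaHat hsub hne hprime hp TpH' HatH' hle' cMH').Cor23iii)
              (_ : (StableCurveTemperedData.ofSpecialFibre (M.toTemperedCurve.ofOpenSubgroup (M.GtpXu l) (M.toThetaSetting.isOpen_GtpXu l) M.K (range_aug_GtpXu_eq_GK C) hDopen) d Sf h36 Sigma SigmaHat hsub hne hprime hp TpH' HatH' hle' cMH').Cor23iv)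
              (_ : (StableCurveTemperedData.ofSpecialFibre (M.toTemperedCurve.ofOpenSubgroup (M.GtpXu l) (M.toThetaSetting.isOpen_GtpXu l) M.K (range_aug_GtpXu_eq_GK C) hDopen) d Sf h36 Sigma SigmaHat hsub hne hprime hp TpH' HatH' hle' cMH').Cor23v)
              (Tw : (StableCurveTemperedData.ofSpecialFibre (M.toTemperedCurve.ofOpenSubgroup (M.GtpXu l) (M.toThetaSetting.isOpen_GtpXu l) M.K (range_aug_GtpXu_eq_GK C) hDopen) d Sf h36 Sigma SigmaHat hsub hne hprime hp TpH' HatH' hle' cMH').Prop24Tower)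
              (V : Tw.I → Subgroup (StableCurveTemperedData.ofSpecialFibre (M.toTemperedCurve.ofOpenSubgroup (M.GtpXu l) (M.toThetaSetting.isOpen_GtpXu l) M.K (range_aug_GtpXu_eq_GK C) hDopen) d Sf h36 Sigma SigmaHat hsub hne hprime hp TpH' HatH' hle' cMH').graph.Hat)
              (_ : ∀ i (y : (StableCurveTemperedData.ofSpecialFibre (M.toTemperedCurve.ofOpenSubgroup (M.GtpXu l) (M.toThetaSetting.isOpen_GtpXu l) M.K (range_aug_GtpXu_eq_GK C) hDopen) d Sf h36 Sigma SigmaHat hsub hne hprime hp TpH' HatH' hle' cMH').DeltaHat),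
                (y : (StableCurveTemperedData.ofSpecialFibre (M.toTemperedCurve.ofOpenSubgroup (M.GtpXu l) (M.toThetaSetting.isOpen_GtpXu l) M.K (range_aug_GtpXu_eq_GK C) hDopen) d Sf h36 Sigma SigmaHat hsub hne hprime hp TpH' HatH' hle' cMH').PiHat) ∈ Tw.Jhat i ↔
                  (StableCurveTemperedData.ofSpecialFibre (M.toTemperedCurve.ofOpenSubgroup (M.GtpXu l) (M.toThetaSetting.isOpen_GtpXu l) M.K (range_aug_GtpXu_eq_GK C) hDopen) d Sf h36 Sigma SigmaHat hsub hne hprime hp TpH' HatH' hle' cMH').ρHat y ∈ V i)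
              (_ : ∀ i, (V i).Normal) (_ : ∀ i, IsOpen (V i : Set (StableCurveTemperedData.ofSpecialFibre (M.toTemperedCurve.ofOpenSubgroup (M.GtpXu l) (M.toThetaSetting.isOpen_GtpXu l) M.K (range_aug_GtpXu_eq_GK C) hDopen) d Sf h36 Sigma SigmaHat hsub hne hprime hp TpH' HatH' hle' cMH').graph.Hat))
              (_ : ∀ O ∈ 𝓝 (1 : (StableCurveTemperedData.ofSpecialFibre (M.toTemperedCurve.ofOpenSubgroup (M.GtpXu l) (M.toThetaSetting.isOpen_GtpXu l) M.K (range_aug_GtpXu_eq_GK C) hDopen) d Sf h36 Sigma SigmaHat hsub hne hprime hp TpH' HatH' hle' cMH').graph.Hat), ∃ i, (V i : Set _) ⊆ O)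
              (Cv : Tw.CoveringLevelGraphs) (Ad : ∀ i, Cv.toLevelData.LevelDatum i),
              (∀ i, (Ad i).lev.Cor23vi) ∧
              (∀ i (γ : (StableCurveTemperedData.ofSpecialFibre (M.toTemperedCurve.ofOpenSubgroup (M.GtpXu l) (M.toThetaSetting.isOpen_GtpXu l) M.K (range_aug_GtpXu_eq_GK C) hDopen) d Sf h36 Sigma SigmaHat hsub hne hprime hp TpH' HatH' hle' cMH').DeltaTp),
                (∀ v ∈ Cv.toLevelData.compH i, Cv.toLevelData.act i
                  (γ : (StableCurveTemperedData.ofSpecialFibre (M.toTemperedCurve.ofOpenSubgroup (M.GtpXu l) (M.toThetaSetting.isOpen_GtpXu l) M.K (range_aug_GtpXu_eq_GK C) hDopen) d Sf h36 Sigma SigmaHat hsub hne hprime hp TpH' HatH' hle' cMH').PiTp) v ∈ Cv.toLevelData.compH i) →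
                  ∃ ĥ ∈ (StableCurveTemperedData.ofSpecialFibre (M.toTemperedCurve.ofOpenSubgroup (M.GtpXu l) (M.toThetaSetting.isOpen_GtpXu l) M.K (range_aug_GtpXu_eq_GK C) hDopen) d Sf h36 Sigma SigmaHat hsub hne hprime hp TpH' HatH' hle' cMH').graph.HatH,
                    ĥ⁻¹ * (StableCurveTemperedData.ofSpecialFibre (M.toTemperedCurve.ofOpenSubgroup (M.GtpXu l) (M.toThetaSetting.isOpen_GtpXu l) M.K (range_aug_GtpXu_eq_GK C) hDopen) d Sf h36 Sigma SigmaHat hsub hne hprime hp TpH' HatH' hle' cMH').graph.ι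
                      ((StableCurveTemperedData.ofSpecialFibre (M.toTemperedCurve.ofOpenSubgroup (M.GtpXu l) (M.toThetaSetting.isOpen_GtpXu l) M.K (range_aug_GtpXu_eq_GK C) hDopen) d Sf h36 Sigma SigmaHat hsub hne hprime hp TpH' HatH' hle' cMH').ρTp γ) ∈ V i) ∧
              (∀ i, (Tw.Jhat i : Set (StableCurveTemperedData.ofSpecialFibre (M.toTemperedCurve.ofOpenSubgroup (M.GtpXu l) (M.toThetaSetting.isOpen_GtpXu l) M.K (range_aug_GtpXu_eq_GK C) hDopen) d Sf h36 Sigma SigmaHat hsub hne hprime hp TpH' HatH' hle' cMH').PiHat) ⊆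
                closure (((T.incl.range.map T.plainIso.toMulEquiv.toMonoidHom).map
                  (StableCurveTemperedData.ofSpecialFibre (M.toTemperedCurve.ofOpenSubgroup (M.GtpXu l) (M.toThetaSetting.isOpen_GtpXu l) M.K (range_aug_GtpXu_eq_GK C) hDopen) d Sf h36 Sigma SigmaHat hsub hne hprime hp TpH HatH hle cuspMeetsH).ιX : Subgroup _) : Set _))) →
          Literature.IUT.HodgeArakelov.Cor24_i' Dec (ofPiCHat e C μ hC hS hl hp2 hpl hζ hη hZ hN T) Cu Ld I := by
  obtain ⟨Cu, A, hhomeo, hA, hlev⟩ := exists_stableCurveAgreement_ofPiCHat_ofSpecialFibre_isHomeomorph e C μ hC hS hl hp2 hpl hζ hη hZ hN T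
    hDopen d Sf h36 Sigma SigmaHat hsub hne hprime hp TpH HatH hle cuspMeetsH
  refine ⟨Cu, A, hhomeo, hA, hlev, fun H h24i hsurj hcap habs hcomm hR2 =>
    cor24_ii_iii'_ofPiCHat_of_specialFibreAgreement e C μ hC hS hl hp2 hpl hζ hη hZ hN T hDopen d Sf h36 Sigma SigmaHat hsub hne
      hprime hp TpH HatH hle cuspMeetsH Cu A hA hlev H h24i hsurj hcap habs hcomm hR2,
    fun x₀ hx₀ => nonempty_cuspidalInertia_piV_of_specialFibreAgreement e C μ hC hS hl hp2 hpl hζ hη hZ hN T hDopen d Sf h36 Sigma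
      SigmaHat hsub hne hprime hp TpH HatH hle cuspMeetsH Cu A hA hlev hx₀,
    fun Ld h24i I GraphTower H hH => ?_⟩
  obtain ⟨TpH', HatH', hle', cMH', hH', hHeq, hHyp', h23iii', h23iv', h23v', Tw, V, hJhat, hVn, hVo, hV, Cv, Ad, h23vi, hst, hJ⟩ :=
    GraphTower H hH
  rw [hHeq]
  exact A.cor24_i_ofSpecialFibre_graphTower_comap hlev (piPM_inf_hat_le_piV_ofPiCHat e C μ hC hS hl hp2 hpl hζ hη hZ hN T).2
    (coe_hat_ofPiCHat_eq_closure e C μ hC hS hl hp2 hpl hζ hη hZ hN T) hhomeo T.plainIso.toMulEquiv hA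
    (range_incl_normal_ofUnderline C μ hC hS hl hp2 hpl hζ hη hN T) (index_range_incl_ne_zero_ofUnderline C μ hC hS hl hp2 hpl hζ hη T)
    h24i I TpH' HatH' hle' cMH' hH' hHyp' h23iii' h23iv' h23v' Tw V hJhat hVn hVo hV Cv Ad h23vi hst hJ

end PlusMinusTower

end Literature.IUT.HodgeArakelov

end
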